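import Literature.Topology.FourManifolds.RadialLinearization
import Literature.Topology.FourManifolds.FishtailCoordinates
import Mathlib.Analysis.InnerProductSpace.Calculus
import Mathlib.Analysis.Complex.Basic
import Mathlib.Analysis.Calculus.Deriv.MeanValue
import HarnessLib

/-!
# Polar coordinates on Gompf's disc, I: the translation diffeomorphism of the cap chart

The disc `D` of Gompf's Lemma 2.2 (in the shear model: the section surface over the torus minus a
hole about the puncture `q₀`, surgered along `C`, plus the collar annulus) has to be parametrised
by polar coordinates about its centre (the south cap point), compatibly with the angular
coordinate about the puncture at its outer edge (`FishtailLambda.lean`). Inside the north cap chart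
`d = t(n) e^{2πis}` (`FishtailCoordinates.lean`) this requires a diffeomorphism of the plane that is
the identity near the latitude circle `|d| = R₂` and the translation by `d₀` (the puncture) on the
disc `|d| ≤ R₁`: the level circles of `|·|` are then carried to a family of nested loops
interpolating between the latitude circle and the circles about the puncture.

* (the derivative bound `|λ'| ≤ transitionLip` for Mathlib's smooth transition is the tree's
  `abs_deriv_smoothTransition_le`, `RadialLinearization.lean`; the statements below take the bound
  as a hypothesis `hC`).
* `Literature.Topology.FourManifolds.transFun d₀ R₁ R₂ ξ = ξ + (1 - λ((|ξ|² - R₁²)/(R₂² - R₁²))) d₀`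
  and its realisation `Literature.Topology.FourManifolds.transDisc` as a diffeomorphism of `ℂ`
  when `4 C R₂ |d₀| ≤ R₂² - R₁²` (`Diffeomorph.ofNormFDerivSubIdLe`: `‖D(transFun) - id‖ ≤ 1/2`),
  with `transDisc ξ = ξ + d₀` for `|ξ| ≤ R₁` and `= ξ` for `|ξ| ≥ R₂`. Since the cap chart
  stretches without bound towards `n → -ε` (`capRad → ∞`), the room `R₂` is always available.

* The **latitude profile** `Literature.Topology.FourManifolds.discLat` of the polar coordinates on
  the south cap and the cylinder: the south latitude `-capLat ε ρ` near the centre (so that the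
  surgery coordinate of the south cap is the polar coordinate itself), blended into an affine
  function near the junction with the north cap chart; smooth with positive derivative
  (`deriv_discLat_pos`, using `hasDerivAt_capLat`), hence strictly increasing.

Everything is proved; no named facts.

## References

* R. E. Gompf, *More Cappell–Shaneson spheres are standard*, Algebr. Geom. Topol. 10 (2010)
  1665–1681, proof of Thm 2.1 and Lemma 2.2. [GompfAGT2010]
* M. W. Hirsch, *Differential Topology*, GTM 33 (1976), Ch. 2 §1. [Hirsch1976]
-/

noncomputable section

open scoped Real ContDiff Topology Manifold
open Set Function Filter

namespace Literature.Topology.FourManifolds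

/-! ### The translation diffeomorphism -/

section Translation

variable (d₀ : ℂ) (R₁ R₂ : ℝ)

/-- The radial cut-off argument `a(ξ) = (|ξ|² - R₁²)/(R₂² - R₁²)`. [folklore] -/
def transArg (R₁ R₂ : ℝ) (ξ : ℂ) : ℝ := (‖ξ‖ ^ 2 - R₁ ^ 2) / (R₂ ^ 2 - R₁ ^ 2)

/-- **The translation map** `ξ ↦ ξ + (1 - λ(a(ξ))) d₀`: translation by `d₀` on `|ξ| ≤ R₁`, the
identity on `|ξ| ≥ R₂`. [folklore] -/
def transFun (ξ : ℂ) : ℂ := ξ + (1 - Real.smoothTransition (transArg R₁ R₂ ξ)) • d₀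

variable {d₀ R₁ R₂}

/-- On the inner disc the map is the translation by `d₀`. [folklore] -/
theorem transFun_of_norm_le (h12 : R₁ < R₂) (h1 : 0 ≤ R₁) {ξ : ℂ} (h : ‖ξ‖ ≤ R₁) :
    transFun d₀ R₁ R₂ ξ = ξ + d₀ := by
  have ha : transArg R₁ R₂ ξ ≤ 0 :=
    div_nonpos_of_nonpos_of_nonneg (by nlinarith [norm_nonneg ξ]) (by nlinarith)
  rw [transFun, Real.smoothTransition.zero_of_nonpos ha, sub_zero, one_smul]

/-- Off the outer disc the map is the identity. [folklore] -/
theorem transFun_of_le_norm (h12 : R₁ < R₂) (h1 : 0 ≤ R₁) {ξ : ℂ} (h : R₂ ≤ ‖ξ‖) :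
    transFun d₀ R₁ R₂ ξ = ξ := by
  have ha : 1 ≤ transArg R₁ R₂ ξ := by
    rw [transArg, le_div_iff₀ (by nlinarith)]
    nlinarith [norm_nonneg ξ]
  rw [transFun, Real.smoothTransition.one_of_one_le ha, sub_self, zero_smul, add_zero]

/-- The cut-off argument is smooth. [folklore] -/
theorem contDiff_transArg (R₁ R₂ : ℝ) : ContDiff ℝ ∞ (transArg R₁ R₂) :=
  ((contDiff_norm_sq ℝ).sub contDiff_const).div_const _

/-- The translation map is smooth. [folklore] -/
theorem contDiff_transFun (d₀ : ℂ) (R₁ R₂ : ℝ) : ContDiff ℝ ∞ (transFun d₀ R₁ R₂) :=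
  contDiff_id.add ((contDiff_const.sub
    (Real.smoothTransition.contDiff.comp (contDiff_transArg R₁ R₂))).smul contDiff_const)

/-- The derivative of the cut-off argument. [folklore] -/
theorem hasFDerivAt_transArg (R₁ R₂ : ℝ) (ξ : ℂ) :
    HasFDerivAt (transArg R₁ R₂) ((R₂ ^ 2 - R₁ ^ 2)⁻¹ • ((2 : ℕ) • innerSL ℝ ξ)) ξ := by
  have h1 : HasFDerivAt (fun ξ : ℂ ↦ ‖ξ‖ ^ 2 - R₁ ^ 2) ((2 : ℕ) • innerSL ℝ ξ) ξ :=
    (hasStrictFDerivAt_norm_sq ξ).hasFDerivAt.sub_const _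
  have h2 := h1.mul_const (R₂ ^ 2 - R₁ ^ 2)⁻¹
  have he : transArg R₁ R₂ = fun ξ : ℂ ↦ (‖ξ‖ ^ 2 - R₁ ^ 2) * (R₂ ^ 2 - R₁ ^ 2)⁻¹ := by
    ext; rw [transArg, div_eq_mul_inv]
  rw [he]
  exact h2

/-- **The derivative of the translation map** is `id + c(ξ) ⟪ξ, ·⟫ d₀` with
`c(ξ) = -2 λ'(a(ξ))/(R₂² - R₁²)`. [folklore] -/
theorem hasFDerivAt_transFun (d₀ : ℂ) (R₁ R₂ : ℝ) (ξ : ℂ) :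
    HasFDerivAt (transFun d₀ R₁ R₂)
      (ContinuousLinearMap.id ℝ ℂ +
        ((-deriv Real.smoothTransition (transArg R₁ R₂ ξ)) •
          ((R₂ ^ 2 - R₁ ^ 2)⁻¹ • ((2 : ℕ) • innerSL ℝ ξ))).smulRight d₀) ξ := by
  have hd : HasDerivAt Real.smoothTransition (deriv Real.smoothTransition (transArg R₁ R₂ ξ))
      (transArg R₁ R₂ ξ) :=
    ((Real.smoothTransition.contDiff (n := 1)).differentiable (by simp) _).hasDerivAt
  have h1 : HasFDerivAt (fun ξ ↦ Real.smoothTransition (transArg R₁ R₂ ξ))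
      (deriv Real.smoothTransition (transArg R₁ R₂ ξ) • ((R₂ ^ 2 - R₁ ^ 2)⁻¹ • ((2 : ℕ) • innerSL ℝ ξ)))
      ξ := hd.comp_hasFDerivAt ξ (hasFDerivAt_transArg R₁ R₂ ξ)
  have h2 : HasFDerivAt (fun ξ ↦ (1 - Real.smoothTransition (transArg R₁ R₂ ξ)) • d₀)
      (((-deriv Real.smoothTransition (transArg R₁ R₂ ξ)) •
        ((R₂ ^ 2 - R₁ ^ 2)⁻¹ • ((2 : ℕ) • innerSL ℝ ξ))).smulRight d₀) ξ := by
    have := ((hasFDerivAt_const (1 : ℝ) ξ).sub h1).smul_const d₀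
    simpa [neg_smul] using this
  exact (hasFDerivAt_id ξ).add h2

/-- **The derivative bound**: if `|λ'| ≤ C`, `0 ≤ R₁ < R₂` and `4 C R₂ |d₀| ≤ R₂² - R₁²`, then
`‖D(transFun)(ξ) - id‖ ≤ 1/2` for all `ξ` (the derivative of the cut-off vanishes for `|ξ| > R₂`
and `|⟪ξ, ·⟫| ≤ R₂` otherwise). [folklore] -/
theorem norm_fderiv_transFun_sub_id_le {C : ℝ} (hC : ∀ x, ‖deriv Real.smoothTransition x‖ ≤ C)
    (h1 : 0 ≤ R₁) (h12 : R₁ < R₂) (hR : 4 * C * R₂ * ‖d₀‖ ≤ R₂ ^ 2 - R₁ ^ 2) (ξ : ℂ) :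
    ‖fderiv ℝ (transFun d₀ R₁ R₂) ξ - ContinuousLinearMap.id ℝ ℂ‖ ≤ 1 / 2 := by
  have hgap : 0 < R₂ ^ 2 - R₁ ^ 2 := by nlinarith
  have hC0 : 0 ≤ C := le_trans (norm_nonneg _) (hC 0)
  rw [(hasFDerivAt_transFun d₀ R₁ R₂ ξ).fderiv, add_sub_cancel_left,
    ContinuousLinearMap.norm_smulRight_apply, norm_smul, norm_smul, ← Nat.cast_smul_eq_nsmul ℝ,
    norm_smul, innerSL_apply_norm, norm_neg, Real.norm_eq_abs, Real.norm_eq_abs,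
    abs_of_pos (inv_pos.2 hgap), Nat.cast_ofNat, Real.norm_two]
  -- case on `|ξ| ≤ R₂`
  rcases le_or_gt ‖ξ‖ R₂ with hle | hgt
  · have hd : |deriv Real.smoothTransition (transArg R₁ R₂ ξ)| ≤ C := by
      simpa [Real.norm_eq_abs] using hC (transArg R₁ R₂ ξ)
    calc |deriv Real.smoothTransition (transArg R₁ R₂ ξ)| * ((R₂ ^ 2 - R₁ ^ 2)⁻¹ * (2 * ‖ξ‖)) * ‖d₀‖
        ≤ C * ((R₂ ^ 2 - R₁ ^ 2)⁻¹ * (2 * R₂)) * ‖d₀‖ := by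
          gcongr
      _ = (4 * C * R₂ * ‖d₀‖) / (R₂ ^ 2 - R₁ ^ 2) / 2 := by
          field_simp
          ring
      _ ≤ 1 / 2 := by
          rw [div_le_iff₀ (by norm_num : (0:ℝ) < 2), div_le_iff₀ hgap]
          linarith
  · have ha : 1 < transArg R₁ R₂ ξ := by
      rw [transArg, lt_div_iff₀ hgap]
      nlinarith [norm_nonneg ξ]
    rw [deriv_smoothTransition_eq_zero (Or.inr ha), abs_zero, zero_mul, zero_mul]
    norm_num

/-- **The translation diffeomorphism of the plane**: `transFun d₀ R₁ R₂` as a diffeomorphism of `ℂ`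
(a `C¹`-small perturbation of the identity, `Diffeomorph.ofNormFDerivSubIdLe`). It is the
translation by `d₀` on `|ξ| ≤ R₁` and the identity on `|ξ| ≥ R₂`. [cite: Hirsch1976, Ch. 2 §1 Thm. 1.6] -/
def transDisc {C : ℝ} (hC : ∀ x, ‖deriv Real.smoothTransition x‖ ≤ C) (h1 : 0 ≤ R₁) (h12 : R₁ < R₂)
    (hR : 4 * C * R₂ * ‖d₀‖ ≤ R₂ ^ 2 - R₁ ^ 2) : ℂ ≃ₘ⟮𝓘(ℝ, ℂ), 𝓘(ℝ, ℂ)⟯ ℂ :=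
  Diffeomorph.ofNormFDerivSubIdLe (transFun d₀ R₁ R₂) (contDiff_transFun d₀ R₁ R₂) (by simp)
    (norm_fderiv_transFun_sub_id_le hC h1 h12 hR)

/-- The underlying map of `transDisc` is `transFun`. [folklore] -/
@[simp] theorem coe_transDisc {C : ℝ} (hC : ∀ x, ‖deriv Real.smoothTransition x‖ ≤ C)
    (h1 : 0 ≤ R₁) (h12 : R₁ < R₂) (hR : 4 * C * R₂ * ‖d₀‖ ≤ R₂ ^ 2 - R₁ ^ 2) :
    ⇑(transDisc hC h1 h12 hR) = transFun d₀ R₁ R₂ := rfl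

/-- On the inner disc the diffeomorphism is the translation by `d₀`. [folklore] -/
theorem transDisc_of_norm_le {C : ℝ} (hC : ∀ x, ‖deriv Real.smoothTransition x‖ ≤ C)
    (h1 : 0 ≤ R₁) (h12 : R₁ < R₂) (hR : 4 * C * R₂ * ‖d₀‖ ≤ R₂ ^ 2 - R₁ ^ 2) {ξ : ℂ}
    (h : ‖ξ‖ ≤ R₁) : transDisc hC h1 h12 hR ξ = ξ + d₀ :=
  transFun_of_norm_le h12 h1 h

/-- Off the outer disc the diffeomorphism is the identity. [folklore] -/
theorem transDisc_of_le_norm {C : ℝ} (hC : ∀ x, ‖deriv Real.smoothTransition x‖ ≤ C)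
    (h1 : 0 ≤ R₁) (h12 : R₁ < R₂) (hR : 4 * C * R₂ * ‖d₀‖ ≤ R₂ ^ 2 - R₁ ^ 2) {ξ : ℂ}
    (h : R₂ ≤ ‖ξ‖) : transDisc hC h1 h12 hR ξ = ξ :=
  transFun_of_le_norm h12 h1 h

/-- **Room is always available**: for every `C > 0`, `R₁ ≥ 0` and `d₀` there is `R₂ > R₁` with
`4 C R₂ |d₀| ≤ R₂² - R₁²` (take `R₂ = R₁ + 4 C |d₀| + 1`). [folklore] -/
theorem exists_transDisc_radius {C : ℝ} (hC : 0 ≤ C) (h1 : 0 ≤ R₁) (d₀ : ℂ) :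
    ∃ R₂, R₁ < R₂ ∧ 4 * C * R₂ * ‖d₀‖ ≤ R₂ ^ 2 - R₁ ^ 2 := by
  refine ⟨R₁ + 4 * C * ‖d₀‖ + 1, by nlinarith [norm_nonneg d₀], ?_⟩
  nlinarith [norm_nonneg d₀, mul_nonneg hC (norm_nonneg d₀)]

end Translation

/-! ### The latitude profile of the polar coordinates (south cap and cylinder) -/

section Latitude

variable {ε : ℝ}

/-- **The derivative of `capLat`**: `n'(t) = -ε / ((1 + t²) √(1 + t²))`. [folklore] -/
theorem hasDerivAt_capLat (ε t : ℝ) :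
    HasDerivAt (capLat ε) (-ε / ((1 + t ^ 2) * Real.sqrt (1 + t ^ 2))) t := by
  have h1 : 0 < 1 + t ^ 2 := by positivity
  have hs : 0 < Real.sqrt (1 + t ^ 2) := Real.sqrt_pos.2 h1
  have hnum : HasDerivAt (fun t ↦ -ε * t) (-ε) t := by
    simpa using (hasDerivAt_id t).const_mul (-ε)
  have hden : HasDerivAt (fun t ↦ Real.sqrt (1 + t ^ 2)) (2 * t / (2 * Real.sqrt (1 + t ^ 2))) t := by
    have h := ((hasDerivAt_pow 2 t).const_add 1).sqrt h1.ne'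
    simpa using h
  have h := hnum.div hden hs.ne'
  have hsq : Real.sqrt (1 + t ^ 2) ^ 2 = 1 + t ^ 2 := Real.sq_sqrt h1.le
  have hfun : capLat ε = (fun t ↦ -ε * t) / fun t ↦ Real.sqrt (1 + t ^ 2) := by
    funext t; rfl
  rw [hfun]
  refine h.congr_deriv ?_
  rw [hsq, div_eq_div_iff h1.ne' (by positivity)]
  field_simp
  rw [hsq]
  ring

/-- `capLat` has negative derivative (for `ε > 0`), so `-capLat` is strictly increasing. [folklore] -/
theorem deriv_capLat_neg (hε : 0 < ε) (t : ℝ) : deriv (capLat ε) t < 0 := by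
  rw [(hasDerivAt_capLat ε t).deriv]
  exact div_neg_of_neg_of_pos (by linarith) (by positivity)

/-- **The south latitude** `n_S(ρ) = -capLat ε ρ = ε ρ/√(1 + ρ²)`: the physical first coordinate
of the point of the south cap at surgery radius `ρ`. [folklore] -/
def southLat (ε ρ : ℝ) : ℝ := -capLat ε ρ

/-- The south latitude is smooth. [folklore] -/
theorem contDiff_southLat (ε : ℝ) : ContDiff ℝ ∞ (southLat ε) := (contDiff_capLat ε).neg

/-- The south latitude has positive derivative. [folklore] -/
theorem hasDerivAt_southLat (ε ρ : ℝ) :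
    HasDerivAt (southLat ε) (ε / ((1 + ρ ^ 2) * Real.sqrt (1 + ρ ^ 2))) ρ := by
  have h := (hasDerivAt_capLat ε ρ).neg
  simp only [neg_div, neg_neg] at h
  exact h

/-- The blend `χ(ρ) = λ((ρ - ρ_a)/(ρ_b - ρ_a))`. [folklore] -/
def latBlend (ρa ρb ρ : ℝ) : ℝ := Real.smoothTransition ((ρ - ρa) / (ρb - ρa))

/-- The derivative of the blend. [folklore] -/
theorem hasDerivAt_latBlend (ρa ρb ρ : ℝ) :
    HasDerivAt (latBlend ρa ρb)
      (deriv Real.smoothTransition ((ρ - ρa) / (ρb - ρa)) * (1 / (ρb - ρa))) ρ := by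
  have hd : HasDerivAt Real.smoothTransition (deriv Real.smoothTransition ((ρ - ρa) / (ρb - ρa)))
      ((ρ - ρa) / (ρb - ρa)) :=
    ((Real.smoothTransition.contDiff (n := 1)).differentiable (by simp) _).hasDerivAt
  have ha : HasDerivAt (fun ρ ↦ (ρ - ρa) / (ρb - ρa)) (1 / (ρb - ρa)) ρ := by
    simpa using ((hasDerivAt_id ρ).sub_const ρa).div_const (ρb - ρa)
  exact hd.comp ρ ha

/-- The derivative of the blend is nonnegative (for `ρ_a < ρ_b`) and vanishes off `[ρ_a, ρ_b]`. [folklore] -/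
theorem deriv_latBlend_nonneg {ρa ρb : ℝ} (hab : ρa < ρb) (ρ : ℝ) :
    0 ≤ deriv Real.smoothTransition ((ρ - ρa) / (ρb - ρa)) * (1 / (ρb - ρa)) :=
  mul_nonneg Real.smoothTransition.monotone.deriv_nonneg (by rw [one_div]; exact (inv_pos.2 (by linarith)).le)

/-- Off `[ρ_a, ρ_b]` the derivative of the blend vanishes. [folklore] -/
theorem deriv_latBlend_eq_zero {ρa ρb : ℝ} (hab : ρa < ρb) {ρ : ℝ} (h : ρ < ρa ∨ ρb < ρ) :
    deriv Real.smoothTransition ((ρ - ρa) / (ρb - ρa)) * (1 / (ρb - ρa)) = 0 := by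
  rw [deriv_smoothTransition_eq_zero, zero_mul]
  rcases h with h | h
  · left; exact div_neg_of_neg_of_pos (by linarith) (by linarith)
  · right; rw [lt_div_iff₀ (by linarith)]; linarith

variable (ε) (n₁ k ρ₁ ρa ρb : ℝ)

/-- **The latitude profile** `n(ρ) = (1 - χ) n_S(ρ) + χ (n₁ + k(ρ - ρ₁))`: the south latitude near
`ρ = 0` (so that the surgery coordinate of the south cap is `ρ` itself), affine near `ρ₁` (so that
the north cap chart continues it exactly, `capLat (capRad (n - 2π)) = n - 2π`). [folklore] -/
def discLat (ρ : ℝ) : ℝ :=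
  (1 - latBlend ρa ρb ρ) * southLat ε ρ + latBlend ρa ρb ρ * (n₁ + k * (ρ - ρ₁))

variable {ε n₁ k ρ₁ ρa ρb}

/-- The latitude profile is smooth. [folklore] -/
theorem contDiff_discLat : ContDiff ℝ ∞ (discLat ε n₁ k ρ₁ ρa ρb) := by
  have hb : ContDiff ℝ ∞ (latBlend ρa ρb) :=
    Real.smoothTransition.contDiff.comp ((contDiff_id.sub contDiff_const).div_const _)
  exact ((contDiff_const.sub hb).mul (contDiff_southLat ε)).add
    (hb.mul (contDiff_const.add (contDiff_const.mul (contDiff_id.sub contDiff_const))))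

/-- Below `ρ_a` the profile is the south latitude. [folklore] -/
theorem discLat_of_le (hab : ρa < ρb) {ρ : ℝ} (h : ρ ≤ ρa) : discLat ε n₁ k ρ₁ ρa ρb ρ = southLat ε ρ := by
  rw [discLat, latBlend, Real.smoothTransition.zero_of_nonpos
    (div_nonpos_of_nonpos_of_nonneg (by linarith) (by linarith))]
  ring

/-- Above `ρ_b` the profile is affine. [folklore] -/
theorem discLat_of_ge (hab : ρa < ρb) {ρ : ℝ} (h : ρb ≤ ρ) :
    discLat ε n₁ k ρ₁ ρa ρb ρ = n₁ + k * (ρ - ρ₁) := by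
  rw [discLat, latBlend, Real.smoothTransition.one_of_one_le ((one_le_div (by linarith)).2 (by linarith))]
  ring

/-- **The derivative of the latitude profile**:
`n' = (1 - χ) n_S' + χ k + χ' (affine - n_S)`. [folklore] -/
theorem hasDerivAt_discLat (ρ : ℝ) :
    HasDerivAt (discLat ε n₁ k ρ₁ ρa ρb)
      ((1 - latBlend ρa ρb ρ) * (ε / ((1 + ρ ^ 2) * Real.sqrt (1 + ρ ^ 2))) +
        latBlend ρa ρb ρ * k +
        deriv Real.smoothTransition ((ρ - ρa) / (ρb - ρa)) * (1 / (ρb - ρa)) *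
          (n₁ + k * (ρ - ρ₁) - southLat ε ρ)) ρ := by
  have hχ := hasDerivAt_latBlend ρa ρb ρ
  have hS := hasDerivAt_southLat ε ρ
  have hA : HasDerivAt (fun ρ ↦ n₁ + k * (ρ - ρ₁)) k ρ := by
    simpa using (((hasDerivAt_id ρ).sub_const ρ₁).const_mul k).const_add n₁
  have h := (((hasDerivAt_const ρ (1 : ℝ)).sub hχ).mul hS).add (hχ.mul hA)
  have hfun : discLat ε n₁ k ρ₁ ρa ρb =
      ((fun _ ↦ (1 : ℝ)) - latBlend ρa ρb) * southLat ε + latBlend ρa ρb * fun ρ ↦ n₁ + k * (ρ - ρ₁) := by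
    funext ρ
    simp only [discLat, Pi.add_apply, Pi.mul_apply, Pi.sub_apply]
  rw [hfun]
  refine h.congr_deriv ?_
  simp only [Pi.sub_apply]
  ring

/-- **The latitude profile has positive derivative** provided `ε, k > 0`, `ρ_a < ρ_b` and the
affine branch dominates the south latitude on the blending interval. [folklore] -/
theorem deriv_discLat_pos (hε : 0 < ε) (hk : 0 < k) (hab : ρa < ρb)
    (hgap : ∀ ρ, ρa ≤ ρ → ρ ≤ ρb → southLat ε ρ ≤ n₁ + k * (ρ - ρ₁)) (ρ : ℝ) :
    0 < deriv (discLat ε n₁ k ρ₁ ρa ρb) ρ := by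
  rw [(hasDerivAt_discLat ρ).deriv]
  have hχ0 : 0 ≤ latBlend ρa ρb ρ := Real.smoothTransition.nonneg _
  have hχ1 : latBlend ρa ρb ρ ≤ 1 := Real.smoothTransition.le_one _
  have hS : 0 < ε / ((1 + ρ ^ 2) * Real.sqrt (1 + ρ ^ 2)) := by positivity
  have h3 : 0 ≤ deriv Real.smoothTransition ((ρ - ρa) / (ρb - ρa)) * (1 / (ρb - ρa)) *
      (n₁ + k * (ρ - ρ₁) - southLat ε ρ) := by
    by_cases h : ρa ≤ ρ ∧ ρ ≤ ρb
    · exact mul_nonneg (deriv_latBlend_nonneg hab ρ) (by linarith [hgap ρ h.1 h.2])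
    · rw [not_and_or, not_le, not_le] at h
      rw [deriv_latBlend_eq_zero hab h, zero_mul]
  have h12 : 0 < (1 - latBlend ρa ρb ρ) * (ε / ((1 + ρ ^ 2) * Real.sqrt (1 + ρ ^ 2))) +
      latBlend ρa ρb ρ * k := by
    rcases eq_or_lt_of_le hχ1 with h1 | h1
    · rw [h1]; linarith
    · nlinarith [mul_nonneg hχ0 hk.le]
  linarith

/-- The latitude profile is strictly increasing (hence injective). [folklore] -/
theorem strictMono_discLat (hε : 0 < ε) (hk : 0 < k) (hab : ρa < ρb)
    (hgap : ∀ ρ, ρa ≤ ρ → ρ ≤ ρb → southLat ε ρ ≤ n₁ + k * (ρ - ρ₁)) :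
    StrictMono (discLat ε n₁ k ρ₁ ρa ρb) :=
  strictMono_of_deriv_pos (deriv_discLat_pos hε hk hab hgap)

end Latitude

end Literature.Topology.FourManifolds
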